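import Mathlib
import Summits.Ventures.PercRepro2.Harris
import Summits.Ventures.PercRepro2.Graph

/-!
# Typed Harris for complementary colourings, with nested bases
(blind cell PercRepro2, night-3 g24, 2026-08-29; `proofs/NIGHT3-CERT.md` §33.9–33.10)

A uniform 2-colouring of the edges is a configuration `ω` (red = open) together with its complement
`flipConfig ω` (blue = open).  For increasing cluster functionals `F, G` the **typed Harris count**
`Σ_ω (F(C_s(ω)) − F(C_s(ω̄)))·(G(C_s(ω)) − G(C_s(ω̄)))` is the `u ≡ 1` case of the typed point-split
count of §32.18 / §33 (the two-copy Bernstein coefficient with the trivial weight); g23 recorded it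
as «believed true in general, not verified here».  It is four applications of Harris' inequality on
the uniform product law (`expect_mul_expect_le_expect_mul`): `ω ↦ F(C_s(ω))` is monotone and
`ω ↦ F(C_s(ω̄))` antitone, so the diagonal products are bounded below and the cross products above
by products of means, and the uniform law is invariant under the complement.  The same argument
gives the **nested-base** version with two pairs `F₂ ≤ F₁`, `G₂ ≤ G₁` — the form produced by a
source whose core is a single vertex (every branch monochromatic; §33.9).

* `flipConfig`, `expect_half_comp_flip` — the uniform law is complement-invariant;
* `expect_mul_le_of_monotone_antitone` — Harris with one monotone and one antitone observable;
* **`typedHarris_nested_nonneg`** — `E_½[(F₁(C_ω) − F₂(C_ω̄))(G₁(C_ω) − G₂(C_ω̄))] ≥ 0` for monotone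
  `F₂ ≤ F₁`, `G₂ ≤ G₁`; **`typedHarris_nonneg`** (`F₁ = F₂`, `G₁ = G₂`);
* **`sum_typedHarris_nonneg`** — the integer-count form `Σ_ω (F(C_ω) − F(C_ω̄))(G(C_ω) − G(C_ω̄)) ≥ 0`.

Own work; standard axioms.
-/

namespace Summit.Ventures.PercRepro2

namespace TypedHarris

variable {V : Type*} {E : Type*} [Fintype E] [DecidableEq E]
  {R : Type*} [Field R] [LinearOrder R] [IsStrictOrderedRing R]

/-- The complementary colouring: every edge flipped. -/
def flipConfig (ω : Config E) : Config E := fun e => !ω e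

omit [Fintype E] [DecidableEq E] in
/-- Flipping twice is the identity. -/
@[simp] lemma flipConfig_flipConfig (ω : Config E) : flipConfig (flipConfig ω) = ω := by
  funext e
  simp [flipConfig]

omit [Fintype E] [DecidableEq E] in
/-- The complement is an involution of the configuration space. -/
lemma flipConfig_involutive : Function.Involutive (flipConfig : Config E → Config E) :=
  flipConfig_flipConfig

omit [Fintype E] [DecidableEq E] in
/-- The complement reverses the configuration order. -/
lemma flipConfig_antitone : Antitone (flipConfig : Config E → Config E) := by
  intro ω ω' h e
  have he := h e
  simp only [flipConfig]
  cases hω : ω e <;> cases hω' : ω' e <;> simp_all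

omit [Fintype E] [DecidableEq E] [Field R] [IsStrictOrderedRing R] in
/-- A monotone observable composed with the complement is antitone. -/
lemma antitone_comp_flip {f : Config E → R} (hf : Monotone f) :
    Antitone (fun ω => f (flipConfig ω)) :=
  fun _ _ h => hf (flipConfig_antitone h)

/-- The uniform weights `p ≡ 1/2`. -/
def half : E → R := fun _ => 1 / 2

omit [Fintype E] [DecidableEq E] in
/-- The uniform weights are admissible. -/
lemma isProbVec_half : IsProbVec (half : E → R) :=
  ⟨fun _ => by norm_num [half], fun _ => by norm_num [half]⟩

omit [DecidableEq E] in
/-- Under the uniform weights every configuration has the same weight. -/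
lemma weight_half (ω : Config E) : weight (half : E → R) ω = (1 / 2) ^ Fintype.card E := by
  unfold weight
  have : ∀ e, edgeFactor ((half : E → R) e) (ω e) = 1 / 2 := by
    intro e
    cases ω e <;> norm_num [half, edgeFactor]
  simp [this]

/-- The uniform law is invariant under the complement. -/
lemma expect_half_comp_flip (f : Config E → R) :
    expect (half : E → R) (fun ω => f (flipConfig ω)) = expect (half : E → R) f := by
  unfold expect
  refine Fintype.sum_bijective flipConfig flipConfig_involutive.bijective _ _ fun ω => ?_
  rw [weight_half, weight_half]

/-- Harris with one monotone and one antitone observable. -/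
lemma expect_mul_le_of_monotone_antitone {p : E → R} (hp : IsProbVec p) {f g : Config E → R}
    (hf : Monotone f) (hg : Antitone g) : expect p (f * g) ≤ expect p f * expect p g := by
  have hg' : Monotone (fun ω => -g ω) := fun _ _ h => neg_le_neg (hg h)
  have key := expect_mul_expect_le_expect_mul hp hf hg'
  have e1 : expect p (fun ω => -g ω) = -expect p g := by
    rw [show (fun ω => -g ω) = fun ω => (-1 : R) * g ω from funext fun ω => by ring,
      expect_const_mul]
    ring
  have e2 : expect p (f * fun ω => -g ω) = -expect p (f * g) := by
    rw [show (f * fun ω => -g ω) = fun ω => (-1 : R) * (f * g) ω from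
      funext fun ω => by simp only [Pi.mul_apply]; ring, expect_const_mul]
    ring
  rw [e1, e2] at key
  linarith

/-- Harris for two antitone observables. -/
lemma expect_mul_expect_le_expect_mul_of_antitone {p : E → R} (hp : IsProbVec p)
    {f g : Config E → R} (hf : Antitone f) (hg : Antitone g) :
    expect p f * expect p g ≤ expect p (f * g) := by
  have hf' : Monotone (fun ω => -f ω) := fun _ _ h => neg_le_neg (hf h)
  have hg' : Monotone (fun ω => -g ω) := fun _ _ h => neg_le_neg (hg h)
  have key := expect_mul_expect_le_expect_mul hp hf' hg'
  have e1 : expect p (fun ω => -f ω) = -expect p f := by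
    rw [show (fun ω => -f ω) = fun ω => (-1 : R) * f ω from funext fun ω => by ring,
      expect_const_mul]
    ring
  have e2 : expect p (fun ω => -g ω) = -expect p g := by
    rw [show (fun ω => -g ω) = fun ω => (-1 : R) * g ω from funext fun ω => by ring,
      expect_const_mul]
    ring
  have e3 : ((fun ω => -f ω) * fun ω => -g ω) = f * g := by
    funext ω
    simp only [Pi.mul_apply]
    ring
  rw [e1, e2, e3] at key
  linarith

/-- **Typed Harris with nested bases**: for monotone cluster functionals `F₂ ≤ F₁`, `G₂ ≤ G₁`,
`E_½[(F₁(C_s(ω)) − F₂(C_s(ω̄)))·(G₁(C_s(ω)) − G₂(C_s(ω̄)))] ≥ 0`. -/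
theorem typedHarris_nested_nonneg (ends : E → Sym2 V) (s : V) {F₁ F₂ G₁ G₂ : Set V → R}
    (hF₁ : Monotone F₁) (hF₂ : Monotone F₂) (hG₁ : Monotone G₁) (hG₂ : Monotone G₂)
    (hF : ∀ S, F₂ S ≤ F₁ S) (hG : ∀ S, G₂ S ≤ G₁ S) :
    0 ≤ expect (half : E → R) (fun ω =>
      (F₁ (cluster ends ω s) - F₂ (cluster ends (flipConfig ω) s)) *
        (G₁ (cluster ends ω s) - G₂ (cluster ends (flipConfig ω) s))) := by
  set p : E → R := half with hpdef
  have hp : IsProbVec p := isProbVec_half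
  -- the four observables
  set f₁ : Config E → R := fun ω => F₁ (cluster ends ω s) with hf₁
  set g₁ : Config E → R := fun ω => G₁ (cluster ends ω s) with hg₁
  set f₂ : Config E → R := fun ω => F₂ (cluster ends (flipConfig ω) s) with hf₂
  set g₂ : Config E → R := fun ω => G₂ (cluster ends (flipConfig ω) s) with hg₂
  have mf₁ : Monotone f₁ := fun _ _ h => hF₁ (cluster_mono h s)
  have mg₁ : Monotone g₁ := fun _ _ h => hG₁ (cluster_mono h s)
  have af₂ : Antitone f₂ := antitone_comp_flip (f := fun ω => F₂ (cluster ends ω s))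
    (fun _ _ h => hF₂ (cluster_mono h s))
  have ag₂ : Antitone g₂ := antitone_comp_flip (f := fun ω => G₂ (cluster ends ω s))
    (fun _ _ h => hG₂ (cluster_mono h s))
  -- expand the product
  have expand : expect p (fun ω => (f₁ ω - f₂ ω) * (g₁ ω - g₂ ω)) =
      expect p (f₁ * g₁) - expect p (f₁ * g₂) - expect p (f₂ * g₁) + expect p (f₂ * g₂) := by
    have : (fun ω => (f₁ ω - f₂ ω) * (g₁ ω - g₂ ω)) =
        ((f₁ * g₁ - f₁ * g₂) - f₂ * g₁) + f₂ * g₂ := by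
      funext ω
      simp only [Pi.add_apply, Pi.sub_apply, Pi.mul_apply]
      ring
    rw [this, expect_add, expect_sub, expect_sub]
  -- the four Harris bounds
  have h11 := expect_mul_expect_le_expect_mul hp mf₁ mg₁
  have h22 := expect_mul_expect_le_expect_mul_of_antitone hp af₂ ag₂
  have h12 := expect_mul_le_of_monotone_antitone hp mf₁ ag₂
  have h21 := expect_mul_le_of_monotone_antitone hp mg₁ af₂
  -- the means of the flipped functionals are the means of the unflipped ones
  have m₂ : expect p f₂ = expect p (fun ω => F₂ (cluster ends ω s)) := by
    rw [hf₂, hpdef]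
    exact expect_half_comp_flip (fun ω => F₂ (cluster ends ω s))
  have n₂ : expect p g₂ = expect p (fun ω => G₂ (cluster ends ω s)) := by
    rw [hg₂, hpdef]
    exact expect_half_comp_flip (fun ω => G₂ (cluster ends ω s))
  have hFm : expect p f₂ ≤ expect p f₁ := by
    rw [m₂]
    exact expect_mono hp fun ω => hF _
  have hGm : expect p g₂ ≤ expect p g₁ := by
    rw [n₂]
    exact expect_mono hp fun ω => hG _
  have prod : 0 ≤ (expect p f₁ - expect p f₂) * (expect p g₁ - expect p g₂) :=
    mul_nonneg (sub_nonneg.2 hFm) (sub_nonneg.2 hGm)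
  show 0 ≤ expect p (fun ω => (f₁ ω - f₂ ω) * (g₁ ω - g₂ ω))
  rw [expand]
  have : (f₂ * g₁) = (g₁ * f₂) := mul_comm _ _
  rw [this]
  nlinarith [h11, h22, h12, h21, prod]

/-- **Typed Harris**: `E_½[(F(C_s(ω)) − F(C_s(ω̄)))·(G(C_s(ω)) − G(C_s(ω̄)))] ≥ 0` for monotone `F, G`
— the `u ≡ 1` case of the typed point-split count (§32.18, §33.6). -/
theorem typedHarris_nonneg (ends : E → Sym2 V) (s : V) {F G : Set V → R} (hF : Monotone F)
    (hG : Monotone G) :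
    0 ≤ expect (half : E → R) (fun ω =>
      (F (cluster ends ω s) - F (cluster ends (flipConfig ω) s)) *
        (G (cluster ends ω s) - G (cluster ends (flipConfig ω) s))) :=
  typedHarris_nested_nonneg ends s hF hF hG hG (fun _ => le_rfl) (fun _ => le_rfl)

/-- The uniform expectation is the plain sum up to the factor `(1/2)^|E|`. -/
lemma expect_half_eq_sum (f : Config E → R) :
    expect (half : E → R) f = (1 / 2) ^ Fintype.card E * ∑ ω, f ω := by
  unfold expect
  rw [Finset.mul_sum]
  refine Finset.sum_congr rfl fun ω _ => ?_
  rw [weight_half]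

/-- **The integer-count form of typed Harris**:
`Σ_ω (F(C_s(ω)) − F(C_s(ω̄)))·(G(C_s(ω)) − G(C_s(ω̄))) ≥ 0` (nested bases allowed). -/
theorem sum_typedHarris_nonneg (ends : E → Sym2 V) (s : V) {F₁ F₂ G₁ G₂ : Set V → R}
    (hF₁ : Monotone F₁) (hF₂ : Monotone F₂) (hG₁ : Monotone G₁) (hG₂ : Monotone G₂)
    (hF : ∀ S, F₂ S ≤ F₁ S) (hG : ∀ S, G₂ S ≤ G₁ S) :
    0 ≤ ∑ ω : Config E, (F₁ (cluster ends ω s) - F₂ (cluster ends (flipConfig ω) s)) *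
        (G₁ (cluster ends ω s) - G₂ (cluster ends (flipConfig ω) s)) := by
  have h := typedHarris_nested_nonneg ends s hF₁ hF₂ hG₁ hG₂ hF hG
  rw [expect_half_eq_sum] at h
  have hpos : (0 : R) < (1 / 2) ^ Fintype.card E := by positivity
  exact (mul_nonneg_iff_of_pos_left hpos).1 h

end TypedHarris

end Summit.Ventures.PercRepro2
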